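import Mathlib
import Summits.Ventures.PercRepro2.Defs
import Summits.Ventures.PercRepro2.Graph
import Summits.Ventures.PercRepro2.Harris
import Summits.Ventures.PercRepro2.Events
import Summits.Ventures.PercRepro2.Induced
import Summits.Ventures.PercRepro2.GateDefs
import Summits.Ventures.PercRepro2.GateShift

/-!
# Anatomy of the free one-sided gate: shift part + within-class covariances (blind cell PercRepro2,
mine-c g7; proofs/MINEC-LIND.md §5, MINE-C.md §14.3)

For the one-sided gate `G = R ∖ {u ∈ C(s), w ∈ C(t)}` (`Gate.gateEvent s {t} {u} {w}`) and its partition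
`A = R ∩ {w ∉ C(t)}`, `B = {w ∈ C(t)} ∩ {s ↮ t, s ↮ u}` the cleared gate expression `E` of `Gate.GateRow`
satisfies the EXACT identity

  `P(A) P(B) E = P(B) [r² covA + (r x_A − x P(A))(r y_A − y P(A))] + P(A) [r² covB + (r x_B − x P(B))(r y_B − y P(B))]`

with `covC = P(C) P(XY; C) − P(X; C) P(Y; C)` (the cleared within-class covariance). The shift part is
nonnegative (`GateShift.gateShift_nonneg`), so the free gate REDUCES to the within-class covariance term:
`0 ≤ P(B) covA + P(A) covB ⟹ GateRow` (whenever both classes have positive mass). `covA ≥ 0` is the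
hull-frame positive association (`GateFrame.hull_frame_pa`); `covB` — the root cluster given «the hull
contains `w`, the root avoids `u`» — is the open content (not sign-definite at `n = 6`).
-/

namespace Summit.Ventures.PercRepro2

namespace GateAnatomy

variable {V : Type*} {E : Type*} [Fintype E] [DecidableEq E] [Fintype V] [DecidableEq V]
  {R : Type*} [Field R] [LinearOrder R] [IsStrictOrderedRing R]

variable (p : E → R) (ends : E → Sym2 V) (s t a b u w : V)

/-- Class `A = R ∩ {w ∉ C(t)}`. -/
def classA : Set (Config E) := avoidAll ends s {t} ∩ (clusterInEvent ends t {W : Set V | w ∈ W})ᶜ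

/-- Class `B = {w ∈ C(t)} ∩ {s ↮ t, s ↮ u}`. -/
def classB : Set (Config E) := clusterInEvent ends t {W : Set V | w ∈ W} ∩ avoidAll ends s ({t} ∪ {u})

omit [DecidableEq E] in
/-- The one-sided gate is the union of the two classes. -/
lemma gate_eq_union : Gate.gateEvent ends s {t} {u} {w} = classA ends s t w ∪ classB ends s t u w := by
  ext ω
  simp only [Gate.gateEvent, Gate.hitsS, Gate.hitsK, classA, classB, avoidAll, clusterInEvent, cluster,
    Set.mem_inter_iff, Set.mem_compl_iff, Set.mem_setOf_eq, Set.mem_union, Finset.mem_singleton,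
    Finset.mem_union, exists_eq_left, forall_eq, forall_eq_or_imp]
  constructor
  · rintro ⟨hst, hn⟩
    by_cases htw : Conn ends ω t w
    · exact Or.inr ⟨htw, hst, fun hsu => hn ⟨hsu, htw⟩⟩
    · exact Or.inl ⟨hst, htw⟩
  · rintro (⟨hst, htw⟩ | ⟨htw, hst, hsu⟩)
    · exact ⟨hst, fun h => htw h.2⟩
    · exact ⟨hst, fun h => hsu h.1⟩

omit [Fintype E] [DecidableEq E] [Fintype V] in
/-- The two classes are disjoint. -/
lemma disjoint_classes : Disjoint (classA ends s t w) (classB ends s t u w) := by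
  rw [Set.disjoint_left]
  rintro ω ⟨_, hA⟩ ⟨hB, _⟩
  exact hA hB

omit [LinearOrder R] [IsStrictOrderedRing R] in
/-- Additivity of every mass over the partition. -/
lemma prob_inter_gate (X : Set (Config E)) :
    prob p (X ∩ Gate.gateEvent ends s {t} {u} {w}) =
      prob p (X ∩ classA ends s t w) + prob p (X ∩ classB ends s t u w) := by
  rw [gate_eq_union, Set.inter_union_distrib_left]
  exact prob_union_of_disjoint p
    (Set.disjoint_of_subset Set.inter_subset_right Set.inter_subset_right (disjoint_classes ends s t u w))

omit [LinearOrder R] [IsStrictOrderedRing R] in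
/-- Additivity of the gate mass. -/
lemma prob_gate :
    prob p (Gate.gateEvent ends s {t} {u} {w}) = prob p (classA ends s t w) + prob p (classB ends s t u w) := by
  rw [gate_eq_union]
  exact prob_union_of_disjoint p (disjoint_classes ends s t u w)

/-- The cleared gate expression of `Gate.GateRow` (so that `GateRow ↔ 0 ≤ gateExpr`). -/
noncomputable def gateExpr : R :=
  prob p (avoidAll ends s {t}) ^ 2 *
        prob p (connAll ends s ({a} ∪ {b}) ∩ Gate.gateEvent ends s {t} {u} {w}) -
      prob p (avoidAll ends s {t}) *
        (prob p (connAll ends s {a} ∩ avoidAll ends s {t}) *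
            prob p (connAll ends s {b} ∩ Gate.gateEvent ends s {t} {u} {w}) +
          prob p (connAll ends s {b} ∩ avoidAll ends s {t}) *
            prob p (connAll ends s {a} ∩ Gate.gateEvent ends s {t} {u} {w})) +
      prob p (connAll ends s {a} ∩ avoidAll ends s {t}) *
        prob p (connAll ends s {b} ∩ avoidAll ends s {t}) * prob p (Gate.gateEvent ends s {t} {u} {w})

omit [Fintype V] [IsStrictOrderedRing R] in
/-- `GateRow` is `0 ≤ gateExpr`. -/
lemma gateRow_iff : Gate.GateRow p ends s {t} a b {u} {w} ↔ 0 ≤ gateExpr p ends s t a b u w := Iff.rfl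

/-- The cleared within-class covariance `P(C) P(XY; C) − P(X; C) P(Y; C)`. -/
noncomputable def covC (C : Set (Config E)) : R :=
  prob p C * prob p (connAll ends s ({a} ∪ {b}) ∩ C) -
    prob p (connAll ends s {a} ∩ C) * prob p (connAll ends s {b} ∩ C)

/-- The shift product of a class, `(r x_C − x P(C))(r y_C − y P(C))`. -/
noncomputable def shiftC (C : Set (Config E)) : R :=
  (prob p (avoidAll ends s {t}) * prob p (connAll ends s {a} ∩ C) -
      prob p (connAll ends s {a} ∩ avoidAll ends s {t}) * prob p C) *
    (prob p (avoidAll ends s {t}) * prob p (connAll ends s {b} ∩ C) -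
      prob p (connAll ends s {b} ∩ avoidAll ends s {t}) * prob p C)

omit [LinearOrder R] [IsStrictOrderedRing R] in
/-- **The anatomy identity**: `P(A) P(B) E = P(B)(r² covA + shiftA) + P(A)(r² covB + shiftB)`. -/
theorem anatomy :
    prob p (classA ends s t w) * prob p (classB ends s t u w) * gateExpr p ends s t a b u w =
      prob p (classB ends s t u w) *
          (prob p (avoidAll ends s {t}) ^ 2 * covC p ends s a b (classA ends s t w) +
            shiftC p ends s t a b (classA ends s t w)) +
        prob p (classA ends s t w) *
          (prob p (avoidAll ends s {t}) ^ 2 * covC p ends s a b (classB ends s t u w) +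
            shiftC p ends s t a b (classB ends s t u w)) := by
  have e1 := prob_inter_gate p ends s t u w (connAll ends s ({a} ∪ {b}))
  have e2 := prob_inter_gate p ends s t u w (connAll ends s {a})
  have e3 := prob_inter_gate p ends s t u w (connAll ends s {b})
  have e4 := prob_gate p ends s t u w
  unfold gateExpr covC shiftC
  rw [e1, e2, e3, e4]
  ring

/-- **Reduction of the free gate to the within-class covariances** (cleared form):
`0 ≤ P(B) covA + P(A) covB ⟹ 0 ≤ P(A) P(B) E`. -/
theorem mul_gateExpr_nonneg (hp : IsProbVec p)
    (h : 0 ≤ prob p (classB ends s t u w) * covC p ends s a b (classA ends s t w) +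
        prob p (classA ends s t w) * covC p ends s a b (classB ends s t u w)) :
    0 ≤ prob p (classA ends s t w) * prob p (classB ends s t u w) * gateExpr p ends s t a b u w := by
  rw [anatomy]
  have hs := GateShift.gateShift_nonneg p ends s t a b u w hp
  have hr : 0 ≤ prob p (avoidAll ends s {t}) ^ 2 := sq_nonneg _
  -- the shift theorem is exactly `0 ≤ P(B) shiftA + P(A) shiftB`
  have hs' : 0 ≤ prob p (classB ends s t u w) * shiftC p ends s t a b (classA ends s t w) +
      prob p (classA ends s t w) * shiftC p ends s t a b (classB ends s t u w) := by
    unfold shiftC classA classB; linarith [hs]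
  nlinarith [h, hs', hr]

/-- **The free gate follows from the within-class covariance term** whenever both classes have
positive mass: `0 ≤ P(B) covA + P(A) covB → Gate.GateRow s {t} a b {u} {w}`. -/
theorem gateRow_of_within (hp : IsProbVec p) (hA : 0 < prob p (classA ends s t w))
    (hB : 0 < prob p (classB ends s t u w))
    (h : 0 ≤ prob p (classB ends s t u w) * covC p ends s a b (classA ends s t w) +
        prob p (classA ends s t w) * covC p ends s a b (classB ends s t u w)) :
    Gate.GateRow p ends s {t} a b {u} {w} := by
  rw [gateRow_iff]
  have := mul_gateExpr_nonneg p ends s t a b u w hp h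
  exact nonneg_of_mul_nonneg_right (by linarith [this]) (mul_pos hA hB) |> fun h' => by
    have hpos : 0 < prob p (classA ends s t w) * prob p (classB ends s t u w) := mul_pos hA hB
    exact (mul_nonneg_iff_of_pos_left hpos).1 this

end GateAnatomy

end Summit.Ventures.PercRepro2
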